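import Summits.Ventures.LatticeQCDFlow.Exactness.FlowSamplerSquareIntegrablePositive
import Summits.Ventures.LatticeQCDFlow.Exactness.FlowSamplerMonotone
import Summits.Ventures.LatticeQCDFlow.Exactness.ReversiblePositiveTauInt
import HarnessLib

/-!
# The exact flow sampler on `L²(e^{−S})`: monotone, convex, log-convex autocovariances; `τ_int ≥ ½ + E[r f²]/E[f²]`; the cross-observable floor — for EVERY square-integrable observable

HONEST FRAMING: exact (Metropolis-corrected) sampling algorithms for lattice gauge theory;
figures of merit are autocorrelation/cost numbers at stated couplings and volumes; no
continuum-physics claim.  (SCALAR calibration rung S0-A: not a gauge result.)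

Venture `LatticeQCDFlow` (cell pub-lqcd), topic `Exactness`; FANOUT row 2 (`s0-phi4`, FLOW arm:
independence Metropolis `K = imhOp μ w q̃`).  NEW WORK of the cell: the flow sampler as an instance of
the tree's `RevOp` format WITH (pos) on the class of measurable SQUARE-INTEGRABLE observables
(hypotheses supplied by `FlowSamplerSquareIntegrable` / `…Contraction` / `…Positive`), hence the
format-level theorems of `ReversiblePositive` / `ReversiblePositiveTauInt` /
`ReversiblePositiveThinning` / `ReversibleVariationalFloorThinned` for unbounded observables such as
the magnetisation.  The bounded-class versions (`FlowSamplerMonotone`, `FlowSamplerTauIntFloor`,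
`Phi4FlowCrossObservableFloor`) stand; nothing is re-derived at the format level.  Nothing is cited
as a fact (Liu 1996, Geyer 1992, Madras–Slade 1993, Sokal 1997 NAMED in the format files).

## What is proved (general `(X, μ)` s-finite; `w > 0` integrable, `q > 0` measurable integrable with
`∫ q = 1`; `g` measurable with `∫ g² w < ∞`; `C(k) = ∫ g (Kᵏ g) w`, `ρ(k) = C(k)/C(0)`)

* `sqClass_*` — the seven `RevOp` hypotheses for `A = {measurable, square-integrable}`;
* **`imhOp_autocov_shape_of_sq`** — for every lag: `0 ≤ C(k+1) ≤ C(k)`,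
  `C(k+1) − C(k+2) ≤ C(k) − C(k+1)`, `C(k+1)² ≤ C(k) C(k+2)`;
* **`imhOp_tauInt_ge_half_add_rejection_of_sq`** — summable series ⇒
  `τ_int(g) ≥ ½ + ρ(1) ≥ ½ + (∫ g² w r)/(∫ g² w)` (`r` the rejection probability): the flow arm's
  STICKING FLOOR for unbounded observables, and no observable beats independent sampling;
* **`imhOp_tauInt_ge_geom_of_sq`** — summable ⇒ `ρ(1) < 1` and `τ_int ≥ (1 + ρ(1))/(2(1 − ρ(1)))`;
* **`imhOp_tauInt_ge_stickingOdds_of_sq`** — summable ⇒ `r̄ < 1` and `τ_int ≥ ½ + r̄/(1 − r̄)`,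
  `r̄ = (∫ g² w r)/(∫ g² w)` the `g²`-weighted mean rejection probability;
* **`imhOp_tauInt_ge_cross_of_sq`** — the CROSS-OBSERVABLE FLOOR `τ_int(g) ≥ (∫ g θ w)²/(∫ g² w · 2R) − ½`
  for square-integrable `g` and the `±1` label `θ` of any measurable `F` at level `c`
  (`R = ∫∫ s χ_flip`);
* **`imhOp_thinned_pinned_of_sq`** — `(τ + ½)/V − ½ ≤ τ^{(V)} ≤ ½ + (τ − ½)/V`.

Lattice instances (every polynomial observable of lattice φ⁴, the magnetisation's tunnelling floor
under the flow arm) are `Phi4FlowSquareIntegrable.lean`.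
NOT CLAIMED: summability / `ρ(1) < 1` for any run; any number for a trained network.
-/

namespace Summit.Ventures.LatticeQCDFlow.Exactness

open Real MeasureTheory Filter Finset Set
open Summit.Ventures.LatticeQCDFlow.Scoring

section General

variable {X : Type*} [MeasurableSpace X] {μ : Measure X} [SFinite μ] {w q : X → ℝ}

/-! ## §1 The `RevOp` hypotheses on the square-integrable class -/

omit [SFinite μ] in
/-- (int). -/
theorem sqClass_int (hw0 : ∀ t, 0 < w t) (hwm : Measurable w) :
    ∀ ⦃f h : X → ℝ⦄, (Measurable f ∧ Integrable (fun t => f t ^ 2 * w t) μ) →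
      (Measurable h ∧ Integrable (fun t => h t ^ 2 * w t) μ) →
      Integrable (fun x => f x * h x * w x) μ :=
  fun _ _ hf hh => integrable_mul_mul_weight_of_sq (fun t => (hw0 t).le) hwm hf.1 hh.1 hf.2 hh.2

omit [SFinite μ] in
/-- (comb). -/
theorem sqClass_comb (hw0 : ∀ t, 0 < w t) (hwm : Measurable w) :
    ∀ ⦃f h : X → ℝ⦄ (c : ℝ), (Measurable f ∧ Integrable (fun t => f t ^ 2 * w t) μ) →
      (Measurable h ∧ Integrable (fun t => h t ^ 2 * w t) μ) →
      (Measurable (fun x => f x + c * h x) ∧ Integrable (fun t => (f t + c * h t) ^ 2 * w t) μ) :=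
  fun _ _ c hf hh => sq_integrable_add_mul (fun t => (hw0 t).le) hwm hf.1 hh.1 hf.2 hh.2 c

/-- (stab). -/
theorem sqClass_stab (hw0 : ∀ t, 0 < w t) (hwm : Measurable w) (hwi : Integrable w μ)
    (hq0 : ∀ t, 0 < q t) (hqm : Measurable q) (hqi : Integrable q μ) (hq1 : ∫ t, q t ∂μ = 1) :
    ∀ ⦃f : X → ℝ⦄, (Measurable f ∧ Integrable (fun t => f t ^ 2 * w t) μ) →
      (Measurable (imhOp μ w q f) ∧ Integrable (fun t => imhOp μ w q f t ^ 2 * w t) μ) :=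
  fun _ hf =>
    let h := imhOp_sq_integrable hw0 hwm hwi hq0 hqm hqi hq1 hf.1 hf.2
    ⟨h.1, h.2.1⟩

omit [SFinite μ] in
/-- (lin). -/
theorem sqClass_lin (hw0 : ∀ t, 0 < w t) (hwm : Measurable w) (hwi : Integrable w μ)
    (hq0 : ∀ t, 0 < q t) (hqm : Measurable q) (hqi : Integrable q μ) :
    ∀ ⦃f h : X → ℝ⦄ (c : ℝ), (Measurable f ∧ Integrable (fun t => f t ^ 2 * w t) μ) →
      (Measurable h ∧ Integrable (fun t => h t ^ 2 * w t) μ) →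
      ∀ x, imhOp μ w q (fun s => f s + c * h s) x = imhOp μ w q f x + c * imhOp μ w q h x :=
  fun _ _ c hf hh => imhOp_add_mul_of_mul_weight hw0 hwm hq0 hqm hqi hf.1 hh.1
    (integrable_mul_weight_of_sq (fun t => (hw0 t).le) hwm hwi hf.1 hf.2)
    (integrable_mul_weight_of_sq (fun t => (hw0 t).le) hwm hwi hh.1 hh.2) c

/-- (symm). -/
theorem sqClass_symm (hw0 : ∀ t, 0 < w t) (hwm : Measurable w) (hwi : Integrable w μ)
    (hq0 : ∀ t, 0 < q t) (hqm : Measurable q) (hqi : Integrable q μ) (hq1 : ∫ t, q t ∂μ = 1) :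
    ∀ ⦃f h : X → ℝ⦄, (Measurable f ∧ Integrable (fun t => f t ^ 2 * w t) μ) →
      (Measurable h ∧ Integrable (fun t => h t ^ 2 * w t) μ) →
      ∫ x, imhOp μ w q f x * h x * w x ∂μ = ∫ x, f x * imhOp μ w q h x * w x ∂μ :=
  fun _ _ hf hh => integral_imhOp_mul_mul_weight_comm hw0 hwm hwi hq0 hqm hqi hq1 hf.1 hh.1 hf.2 hh.2

/-- (contr). -/
theorem sqClass_contr (hw0 : ∀ t, 0 < w t) (hwm : Measurable w) (hwi : Integrable w μ)
    (hq0 : ∀ t, 0 < q t) (hqm : Measurable q) (hqi : Integrable q μ) (hq1 : ∫ t, q t ∂μ = 1) :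
    ∀ ⦃f : X → ℝ⦄, (Measurable f ∧ Integrable (fun t => f t ^ 2 * w t) μ) →
      ∫ x, imhOp μ w q f x ^ 2 * w x ∂μ ≤ ∫ x, f x ^ 2 * w x ∂μ :=
  fun _ hf => (imhOp_sq_integrable hw0 hwm hwi hq0 hqm hqi hq1 hf.1 hf.2).2.2

/-- (pos). -/
theorem sqClass_pos (hw0 : ∀ t, 0 < w t) (hwm : Measurable w) (hwi : Integrable w μ)
    (hq0 : ∀ t, 0 < q t) (hqm : Measurable q) (hqi : Integrable q μ) (hq1 : ∫ t, q t ∂μ = 1) :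
    ∀ ⦃f : X → ℝ⦄, (Measurable f ∧ Integrable (fun t => f t ^ 2 * w t) μ) →
      0 ≤ ∫ x, f x * imhOp μ w q f x * w x ∂μ :=
  fun _ hf => integral_mul_imhOp_mul_nonneg_of_sq hw0 hwm hwi hq0 hqm hqi hq1 hf.1 hf.2

/-! ## §2 The shape of the autocovariance sequence of every square-integrable observable -/

/-- **THE FLOW SAMPLER DECORRELATES EVERY SQUARE-INTEGRABLE OBSERVABLE MONOTONICALLY, CONVEXLY AND
LOG-CONVEXLY**: for every lag `k`, `0 ≤ C(k+1) ≤ C(k)`, `C(k+1) − C(k+2) ≤ C(k) − C(k+1)` and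
`C(k+1)² ≤ C(k) C(k+2)` — for the magnetisation, its powers, the action: no anti-correlation, no
overshoot, whatever the model density. -/
theorem imhOp_autocov_shape_of_sq (hw0 : ∀ t, 0 < w t) (hwm : Measurable w)
    (hwi : Integrable w μ) (hq0 : ∀ t, 0 < q t) (hqm : Measurable q) (hqi : Integrable q μ)
    (hq1 : ∫ t, q t ∂μ = 1) {g : X → ℝ} (hgm : Measurable g)
    (hg2 : Integrable (fun t => g t ^ 2 * w t) μ) (k : ℕ) :
    0 ≤ ∫ t, g t * ((imhOp μ w q)^[k + 1] g) t * w t ∂μ ∧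
    ∫ t, g t * ((imhOp μ w q)^[k + 1] g) t * w t ∂μ ≤ ∫ t, g t * ((imhOp μ w q)^[k] g) t * w t ∂μ ∧
    (∫ t, g t * ((imhOp μ w q)^[k + 1] g) t * w t ∂μ) - ∫ t, g t * ((imhOp μ w q)^[k + 2] g) t * w t ∂μ
      ≤ (∫ t, g t * ((imhOp μ w q)^[k] g) t * w t ∂μ)
        - ∫ t, g t * ((imhOp μ w q)^[k + 1] g) t * w t ∂μ ∧
    (∫ t, g t * ((imhOp μ w q)^[k + 1] g) t * w t ∂μ) ^ 2
      ≤ (∫ t, g t * ((imhOp μ w q)^[k] g) t * w t ∂μ)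
        * ∫ t, g t * ((imhOp μ w q)^[k + 2] g) t * w t ∂μ := by
  have hw0' : ∀ t, 0 ≤ w t := fun t => (hw0 t).le
  have hAi := sqClass_int (μ := μ) hw0 hwm
  have hAc := sqClass_comb (μ := μ) hw0 hwm
  have hAK := sqClass_stab hw0 hwm hwi hq0 hqm hqi hq1
  have hlin := sqClass_lin hw0 hwm hwi hq0 hqm hqi
  have hsymm := sqClass_symm hw0 hwm hwi hq0 hqm hqi hq1
  have hcontr := sqClass_contr hw0 hwm hwi hq0 hqm hqi hq1
  have hpos := sqClass_pos hw0 hwm hwi hq0 hqm hqi hq1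
  have hg : Measurable g ∧ Integrable (fun t => g t ^ 2 * w t) μ := ⟨hgm, hg2⟩
  exact ⟨RevOp.autocov_nonneg_of_pos (A := fun f : X → ℝ => Measurable f ∧
        Integrable (fun t => f t ^ 2 * w t) μ) (K := imhOp μ w q) hw0' hAK hsymm hpos hg (k + 1),
    RevOp.autocov_succ_le_of_pos (A := fun f : X → ℝ => Measurable f ∧
        Integrable (fun t => f t ^ 2 * w t) μ) (K := imhOp μ w q) hw0' hAi hAc hAK hlin hsymm hcontr
      hpos hg k,
    RevOp.autocov_convex_of_pos (A := fun f : X → ℝ => Measurable f ∧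
        Integrable (fun t => f t ^ 2 * w t) μ) (K := imhOp μ w q) hw0' hAi hAc hAK hlin hsymm hpos
      hg k,
    RevOp.autocov_logConvex_of_pos (A := fun f : X → ℝ => Measurable f ∧
        Integrable (fun t => f t ^ 2 * w t) μ) (K := imhOp μ w q) hw0' hAi hAc hAK hlin hsymm hpos
      hg k⟩

/-! ## §3 `τ_int` floors for every square-integrable observable -/

/-- **NO SQUARE-INTEGRABLE OBSERVABLE BEATS INDEPENDENT SAMPLING, AND THE STICKING FLOOR**: if the
autocorrelation series of `g` is summable, then
`½ + (∫ g² w r)/(∫ g² w) ≤ ½ + ρ(1) ≤ τ_int(g)` (`r(t) = ∫ (1 − α(t,t')) q(t') dt'` the rejection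
probability from `t`; for the centred magnetisation the middle floor reads `½ + E[r (M−⟨M⟩)²]/Var M`). -/
theorem imhOp_tauInt_ge_half_add_rejection_of_sq (hw0 : ∀ t, 0 < w t) (hwm : Measurable w)
    (hwi : Integrable w μ) (hq0 : ∀ t, 0 < q t) (hqm : Measurable q) (hqi : Integrable q μ)
    (hq1 : ∫ t, q t ∂μ = 1) {g : X → ℝ} (hgm : Measurable g)
    (hg2 : Integrable (fun t => g t ^ 2 * w t) μ)
    (hs : Summable fun k => (∫ t, g t * ((imhOp μ w q)^[k + 1] g) t * w t ∂μ)
      / ∫ t, g t ^ 2 * w t ∂μ) :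
    1 / 2 + (∫ t, g t ^ 2 * w t * (∫ t', (1 - imhAcceptQ w q t t') * q t' ∂μ) ∂μ)
        / (∫ t, g t ^ 2 * w t ∂μ)
      ≤ 1 / 2 + (∫ t, g t * imhOp μ w q g t * w t ∂μ) / (∫ t, g t ^ 2 * w t ∂μ) ∧
    1 / 2 + (∫ t, g t * imhOp μ w q g t * w t ∂μ) / (∫ t, g t ^ 2 * w t ∂μ)
      ≤ tauInt (fun k => (∫ t, g t * ((imhOp μ w q)^[k] g) t * w t ∂μ) / ∫ t, g t ^ 2 * w t ∂μ) := by
  have hw0' : ∀ t, 0 ≤ w t := fun t => (hw0 t).le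
  have hAK := sqClass_stab hw0 hwm hwi hq0 hqm hqi hq1
  have hsymm := sqClass_symm hw0 hwm hwi hq0 hqm hqi hq1
  have hpos := sqClass_pos hw0 hwm hwi hq0 hqm hqi hq1
  have hg : Measurable g ∧ Integrable (fun t => g t ^ 2 * w t) μ := ⟨hgm, hg2⟩
  have h := RevOp.half_le_tauInt_of_pos (A := fun f : X → ℝ => Measurable f ∧
      Integrable (fun t => f t ^ 2 * w t) μ) (K := imhOp μ w q) hw0' hAK hsymm hpos hg hs
  refine ⟨?_, h.2⟩
  have hP0 : 0 ≤ ∫ t, g t ^ 2 * w t ∂μ := integral_nonneg fun t => mul_nonneg (sq_nonneg _) (hw0' t)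
  have hfloor := integral_sq_mul_rejection_le_of_sq hw0 hwm hwi hq0 hqm hqi hq1 hgm hg2
  have hdiv := div_le_div_of_nonneg_right hfloor hP0
  linarith

/-- **THE GEOMETRIC (MADRAS–SLADE) FLOOR FOR EVERY SQUARE-INTEGRABLE OBSERVABLE**: a summable series
forces `ρ(1) < 1`, and `τ_int ≥ (1 + ρ(1))/(2(1 − ρ(1)))`. -/
theorem imhOp_tauInt_ge_geom_of_sq (hw0 : ∀ t, 0 < w t) (hwm : Measurable w)
    (hwi : Integrable w μ) (hq0 : ∀ t, 0 < q t) (hqm : Measurable q) (hqi : Integrable q μ)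
    (hq1 : ∫ t, q t ∂μ = 1) {g : X → ℝ} (hgm : Measurable g)
    (hg2 : Integrable (fun t => g t ^ 2 * w t) μ)
    (hs : Summable fun k => (∫ t, g t * ((imhOp μ w q)^[k + 1] g) t * w t ∂μ)
      / ∫ t, g t ^ 2 * w t ∂μ) :
    (∫ t, g t * imhOp μ w q g t * w t ∂μ) / (∫ t, g t ^ 2 * w t ∂μ) < 1 ∧
    (1 + (∫ t, g t * imhOp μ w q g t * w t ∂μ) / ∫ t, g t ^ 2 * w t ∂μ)
        / (2 * (1 - (∫ t, g t * imhOp μ w q g t * w t ∂μ) / ∫ t, g t ^ 2 * w t ∂μ))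
      ≤ tauInt (fun k => (∫ t, g t * ((imhOp μ w q)^[k] g) t * w t ∂μ) / ∫ t, g t ^ 2 * w t ∂μ) := by
  have hw0' : ∀ t, 0 ≤ w t := fun t => (hw0 t).le
  exact RevOp.tauInt_ge_geom_of_pos (A := fun f : X → ℝ => Measurable f ∧
      Integrable (fun t => f t ^ 2 * w t) μ) (K := imhOp μ w q) hw0' (sqClass_int hw0 hwm)
    (sqClass_comb hw0 hwm) (sqClass_stab hw0 hwm hwi hq0 hqm hqi hq1)
    (sqClass_lin hw0 hwm hwi hq0 hqm hqi) (sqClass_symm hw0 hwm hwi hq0 hqm hqi hq1)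
    (sqClass_pos hw0 hwm hwi hq0 hqm hqi hq1) ⟨hgm, hg2⟩ hs

/-- **THE STICKING-ODDS FLOOR FOR EVERY SQUARE-INTEGRABLE OBSERVABLE**: with
`r̄ = (∫ g² w r)/(∫ g² w)` the `g²`-weighted mean rejection probability of the flow proposal, a
summable series forces `r̄ < 1` and `τ_int(g) ≥ (1 + r̄)/(2(1 − r̄)) = ½ + r̄/(1 − r̄)`
(the geometric floor at `ρ(1) ≥ r̄`; the bounded-class version is `FlowSamplerTauIntFloor`). -/
theorem imhOp_tauInt_ge_stickingOdds_of_sq (hw0 : ∀ t, 0 < w t) (hwm : Measurable w)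
    (hwi : Integrable w μ) (hq0 : ∀ t, 0 < q t) (hqm : Measurable q) (hqi : Integrable q μ)
    (hq1 : ∫ t, q t ∂μ = 1) {g : X → ℝ} (hgm : Measurable g)
    (hg2 : Integrable (fun t => g t ^ 2 * w t) μ)
    (hs : Summable fun k => (∫ t, g t * ((imhOp μ w q)^[k + 1] g) t * w t ∂μ)
      / ∫ t, g t ^ 2 * w t ∂μ) :
    (∫ t, g t ^ 2 * w t * (∫ t', (1 - imhAcceptQ w q t t') * q t' ∂μ) ∂μ)
        / (∫ t, g t ^ 2 * w t ∂μ) < 1 ∧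
    (1 + (∫ t, g t ^ 2 * w t * (∫ t', (1 - imhAcceptQ w q t t') * q t' ∂μ) ∂μ)
          / ∫ t, g t ^ 2 * w t ∂μ)
        / (2 * (1 - (∫ t, g t ^ 2 * w t * (∫ t', (1 - imhAcceptQ w q t t') * q t' ∂μ) ∂μ)
          / ∫ t, g t ^ 2 * w t ∂μ))
      ≤ tauInt (fun k => (∫ t, g t * ((imhOp μ w q)^[k] g) t * w t ∂μ) / ∫ t, g t ^ 2 * w t ∂μ) := by
  have hgeom := imhOp_tauInt_ge_geom_of_sq hw0 hwm hwi hq0 hqm hqi hq1 hgm hg2 hs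
  have hstick := (imhOp_tauInt_ge_half_add_rejection_of_sq hw0 hwm hwi hq0 hqm hqi hq1 hgm hg2 hs).1
  set rb := (∫ t, g t ^ 2 * w t * (∫ t', (1 - imhAcceptQ w q t t') * q t' ∂μ) ∂μ)
    / ∫ t, g t ^ 2 * w t ∂μ with hrb
  set ρ1 := (∫ t, g t * imhOp μ w q g t * w t ∂μ) / ∫ t, g t ^ 2 * w t ∂μ with hρ1
  have hr : rb ≤ ρ1 := by linarith
  have hρ : ρ1 < 1 := hgeom.1
  refine ⟨lt_of_le_of_lt hr hρ, le_trans ?_ hgeom.2⟩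
  rw [div_le_div_iff₀ (by linarith) (by linarith)]
  nlinarith

/-- **THE CROSS-OBSERVABLE FLOOR FOR SQUARE-INTEGRABLE OBSERVABLES (general space).**  `g` measurable
square-integrable, `F` measurable, `c` a level, `θ = ±1` the label of `{c ≤ F}`,
`R = ∫∫ min(w(t) q(t'), w(t') q(t)) χ_flip(t,t')`.  If the autocorrelation series of `g` is summable,
`τ_int(g) ≥ (∫ g θ w)² / (∫ g² w · 2R) − ½`. -/
theorem imhOp_tauInt_ge_cross_of_sq (hw0 : ∀ t, 0 < w t) (hwm : Measurable w)
    (hwi : Integrable w μ) (hq0 : ∀ t, 0 < q t) (hqm : Measurable q) (hqi : Integrable q μ)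
    (hq1 : ∫ t, q t ∂μ = 1) {g : X → ℝ} (hgm : Measurable g)
    (hg2 : Integrable (fun t => g t ^ 2 * w t) μ) {F : X → ℝ} (hF : Measurable F) (c : ℝ)
    (hs : Summable fun k => (∫ t, g t * ((imhOp μ w q)^[k + 1] g) t * w t ∂μ)
      / ∫ t, g t ^ 2 * w t ∂μ) :
    (∫ t, g t * (if c ≤ F t then (1 : ℝ) else -1) * w t ∂μ) ^ 2
          / ((∫ t, g t ^ 2 * w t ∂μ) * (2 * ∫ p, imhFlow w q p.1 p.2
            * (if (c ≤ F p.1 ↔ c ≤ F p.2) then (0 : ℝ) else 1) ∂(μ.prod μ))) - 1 / 2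
      ≤ tauInt (fun k => (∫ t, g t * ((imhOp μ w q)^[k] g) t * w t ∂μ) / ∫ t, g t ^ 2 * w t ∂μ) := by
  have hw0' : ∀ t, 0 ≤ w t := fun t => (hw0 t).le
  -- the label: bounded, hence square-integrable; its Dirichlet form is `2R`
  have hθm : Measurable (fun t => if c ≤ F t then (1 : ℝ) else -1) :=
    Measurable.ite (measurableSet_le measurable_const hF) measurable_const measurable_const
  have hθb : ∀ t, |(if c ≤ F t then (1 : ℝ) else -1)| ≤ 1 := fun t => by split_ifs <;> norm_num
  have hθ2 := sq_integrable_of_bdd hw0' hwm hwi hθm hθb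
  have hdir := dirichlet_eq_half_sq hw0 hwm hwi hq0 hqm hqi hq1 hθm hθb
  have hdir' : (∫ t, (if c ≤ F t then (1 : ℝ) else -1) ^ 2 * w t ∂μ)
      - ∫ t, (if c ≤ F t then (1 : ℝ) else -1)
          * imhOp μ w q (fun s => if c ≤ F s then (1 : ℝ) else -1) t * w t ∂μ
      ≤ 2 * ∫ p, imhFlow w q p.1 p.2 * (if (c ≤ F p.1 ↔ c ≤ F p.2) then (0 : ℝ) else 1) ∂(μ.prod μ) := by
    rw [hdir]
    have e : ∀ p : X × X, imhFlow w q p.1 p.2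
          * ((if c ≤ F p.1 then (1 : ℝ) else -1) - (if c ≤ F p.2 then (1 : ℝ) else -1)) ^ 2
        = 4 * (imhFlow w q p.1 p.2 * (if (c ≤ F p.1 ↔ c ≤ F p.2) then (0 : ℝ) else 1)) := by
      intro p
      rw [label_sq_sub_eq_four_mul_flip]
      ring
    simp_rw [e]
    rw [integral_const_mul]
    linarith
  exact RevOp.tauInt_ge_variational_of_le (A := fun f : X → ℝ => Measurable f ∧
      Integrable (fun t => f t ^ 2 * w t) μ) (K := imhOp μ w q) hw0' (sqClass_int hw0 hwm)
    (sqClass_comb hw0 hwm) (sqClass_stab hw0 hwm hwi hq0 hqm hqi hq1)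
    (sqClass_lin hw0 hwm hwi hq0 hqm hqi) (sqClass_symm hw0 hwm hwi hq0 hqm hqi hq1)
    (sqClass_contr hw0 hwm hwi hq0 hqm hqi hq1) ⟨hgm, hg2⟩ ⟨hθm, hθ2⟩ hs hdir'

/-- **THINNING IS PINNED FOR EVERY SQUARE-INTEGRABLE OBSERVABLE**: `∫ g² w > 0`, summable series,
`V ≥ 1` proposals per recorded state: `(τ + ½)/V − ½ ≤ τ^{(V)} ≤ ½ + (τ − ½)/V`. -/
theorem imhOp_thinned_pinned_of_sq (hw0 : ∀ t, 0 < w t) (hwm : Measurable w)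
    (hwi : Integrable w μ) (hq0 : ∀ t, 0 < q t) (hqm : Measurable q) (hqi : Integrable q μ)
    (hq1 : ∫ t, q t ∂μ = 1) {g : X → ℝ} (hgm : Measurable g)
    (hg2 : Integrable (fun t => g t ^ 2 * w t) μ)
    (hP : 0 < ∫ t, g t ^ 2 * w t ∂μ) {V : ℕ} (hV : 1 ≤ V)
    (hs : Summable fun n => (∫ t, g t * ((imhOp μ w q)^[n + 1] g) t * w t ∂μ)
      / ∫ t, g t ^ 2 * w t ∂μ) :
    (tauInt (fun n => (∫ t, g t * ((imhOp μ w q)^[n] g) t * w t ∂μ) / ∫ t, g t ^ 2 * w t ∂μ)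
        + 1 / 2) / V - 1 / 2
      ≤ tauInt (fun n => (∫ t, g t * ((imhOp μ w q)^[V * n] g) t * w t ∂μ)
        / ∫ t, g t ^ 2 * w t ∂μ) ∧
    tauInt (fun n => (∫ t, g t * ((imhOp μ w q)^[V * n] g) t * w t ∂μ) / ∫ t, g t ^ 2 * w t ∂μ)
      ≤ 1 / 2 + (tauInt (fun n => (∫ t, g t * ((imhOp μ w q)^[n] g) t * w t ∂μ)
        / ∫ t, g t ^ 2 * w t ∂μ) - 1 / 2) / V := by
  have hw0' : ∀ t, 0 ≤ w t := fun t => (hw0 t).le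
  exact RevOp.thinned_tauInt_pinned_of_pos (A := fun f : X → ℝ => Measurable f ∧
      Integrable (fun t => f t ^ 2 * w t) μ) (K := imhOp μ w q) hw0' (sqClass_int hw0 hwm)
    (sqClass_comb hw0 hwm) (sqClass_stab hw0 hwm hwi hq0 hqm hqi hq1)
    (sqClass_lin hw0 hwm hwi hq0 hqm hqi) (sqClass_symm hw0 hwm hwi hq0 hqm hqi hq1)
    (sqClass_contr hw0 hwm hwi hq0 hqm hqi hq1) (sqClass_pos hw0 hwm hwi hq0 hqm hqi hq1)
    ⟨hgm, hg2⟩ hP hV hs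

end General

end Summit.Ventures.LatticeQCDFlow.Exactness
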